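import Literature.NumberTheory.EllipticCurves.IwasawaSelmer
import Literature.NumberTheory.EllipticCurves.KatoFineSelmerDual
import Literature.NumberTheory.EllipticCurves.GlobalMinimalModel
import Literature.NumberTheory.EllipticCurves.Tamagawa
import HarnessLib

/-!
# The `Λ`-torsion submodule of `X(E/ℚ_∞) = Sel_{p^∞}(E/ℚ_∞)^∨` at a good SUPERSINGULAR prime is pseudo-isomorphic to the
# `ι`-twist of the dual fine Selmer group `X₀(E/ℚ_∞)` (A. Matar, Asian J. Math. 24 (2020), Thm. 1.1 with Thm. 2.2 and
# Prop. 1.2 (ii); the Galois-cohomological form of K. Wingberg 1989, Cor. 2.5) — ONE named fact on the tree's pinned duals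

Topic `NumberTheory/EllipticCurves`; namespace `Literature.NumberTheory.EllipticCurves` (= path). Written by the width
seat `cruxlead-stmt-BirchSwinnertonDyer-19875-w2` (gen 9, cell `bsd-ssimc`) for the cokernel bound «F-α♮» of the x8 children
of crux `SprungLowerDivisibilityAtThree` (items stmt-BirchSwinnertonDyer-22569 / 22901 / 22570 / 23112, registered stub
`IotaDoor.stub_cokerBoundIotaOffT`): the `ι` in «`j(𝔭) ≤ x₀(ι𝔭)`» IS this theorem. HONEST FRAMING: a named fact
(`def … : Prop`, D-0014), nothing asserted, no `_holds` (the proof is a Poitou–Tate / Hochschild–Serre limit argument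
along the tower, §2 of the paper, on Galois cohomology the tree does not carry as theorems — size L/XL); typed ≠ proved.
No summit statement, no crux and no BSD case is proved by this file.

## The printed statements (A. Matar, *On the Λ-cotorsion subgroup of the Selmer group*, Asian J. Math. 24 (2020) no. 3,
## 437–456 = arXiv:1812.00207; held text `paper:arxiv-1812.00207`, chunks p0002–p0005 read by this seat 2026-08-28)

Notation (p0002): "`Λ = ℤ_p[[Γ]]` … If `A` is a finitely generated `Λ`-module, we let `T_Λ(A)` denote its `Λ`-torsion
submodule. Also we let `Ȧ` be the `Λ`-module `A` with the inverse `Λ`-action: `γ · a = γ⁻¹ a` for `a ∈ A`, `γ ∈ Γ`. We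
denote `T_Λ(Ȧ)` by `Ṫ_Λ(A)`." `Sel_{p^∞}(E/L) = Ker(H¹(G_S(L), E[p^∞]) → ∏_{v ∈ S_L} H¹(L_v, E)[p^∞])` and the fine
group `R_{p^∞}(E/L) = Ker(H¹(G_S(L), E[p^∞]) → ∏_{v ∈ S_L} H¹(L_v, E[p^∞]))` (p0002).
**Theorem 1.1** (p0003): "Let `K` be a number field, `E` an elliptic curve defined over `K` and `p` a rational prime such
that `E` has good supersingular reduction at all primes of `K` above `p`. Let `K_∞/K` be a `ℤ_p`-extension such that every
prime of `K` above `p` ramifies and such that: (i) `E(K_∞)[p^∞]` is finite (ii) `H²(G_S(K_∞), E[p^∞]) = 0`. Then there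
exists a pseudo-isomorphism `Ṫ_Λ(Sel_{p^∞}(E/K_∞)^*) ∼ R_{p^∞}(E/K_∞)^*`."
**Proposition 1.2** (p0004): "With the setup and conditions in theorem 1.1, we have that `E(K_∞)[p^∞]` is finite in the
following cases: • `E` does not have complex multiplication • `K_∞/K` is the cyclotomic `ℤ_p`-extension of `K` • `p` is odd
and splits in `K/ℚ`" ((ii): "Follows from Ribet's theorem").
**Theorem 2.2** (p0005): "… Then `R_{p^∞}(E/K_∞)^*` is `Λ`-torsion if and only if `Ш²(G_S(K_∞), E[p^∞])^*` is
`Λ`-torsion. If `p` is odd, this statement is equivalent to `H²(G_S(K_∞), E[p^∞]) = 0`."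
Also p0003: "Wingberg ([Wingberg1] corollary 2.5) has proven a similar result … stated in terms of flat cohomology".

## The Lean statement (the special case `K = ℚ`, `K_∞ = ℚ_∞` cyclotomic, `p` odd — every prime above `p` ramifies)

`W/ℚ` a globally minimal elliptic curve, `p ≠ 2` a prime of good supersingular reduction (`W.HasGoodReductionAtPrime p`,
`p ∣ a_p(W)` — ANY supersingular `a_p`, in particular `(3, ±3)`), `κ` the cyclotomic `ℤ_p`-extension of `ℚ` with a
topological generator `γ` and `γ'` with `γ·γ' = 1` (so `γ' = γ⁻¹`, also a topological generator). Hypothesis (i) is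
DISCHARGED IN PRINT by Prop. 1.2 (ii) (cyclotomic tower), hence absent; hypothesis (ii) is carried in the equivalent form
of Thm. 2.2 for odd `p`: the dual fine Selmer group is `Λ`-torsion (`Module.IsTorsion Λ Y'.X`). Conclusion: for EVERY
Pontryagin-dual datum `S : W.SelmerDualData κ γ` of `Sel_{p^∞}(E/ℚ_∞)` (`T` acting as `x ↦ x ∘ conj_γ − x`) and EVERY
dual datum `Y' : W.FineSelmerDualData κ γ'` of the fine Selmer group keyed by the INVERSE generator (`T` acting as
`x ↦ x ∘ conj_{γ⁻¹} − x`), the `Λ`-torsion submodule of `S.X` is pseudo-isomorphic to `Y'.X`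
(`Module.ArePseudoIsomorphic Λ (torsion Λ S.X) Y'.X`: a `Λ`-linear map with pseudo-null kernel and cokernel).
KEYING (why `γ` versus `γ'`, and why this is convention-proof): `S` and a fine datum `Y` of the SAME key `γ` carry the SAME
`Λ`-structure convention, and `Y'` of key `γ⁻¹` is the `ι`-twist `Y^ι` of `Y` (tree theorem
`Kato2004.fineSelmerDualData_exists_involTwist`); the typed sentence therefore reads «`T_Λ(X) ∼ (X₀)^ι` for duals taken in
one and the same convention», which is the printed `Ṫ_Λ(Sel^*) ∼ R^*` (twist both sides by `ι`: `Ṫ_Λ(A) = T_Λ(A^ι)`)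
WHICHEVER of the two conventions (`x ∘ conj_γ` or `x ∘ conj_{γ⁻¹}` for `γ ↦ 1 + T`) is the paper's `Λ`-action on a
Pontryagin dual; and the binder pair `(γ, γ')` ranges over both orders. Direction of the pseudo-isomorphism as printed
(from the torsion of the Selmer dual to the fine dual); for finitely generated torsion `Λ`-modules the relation is
symmetric (tree: `Module.arePseudoIsomorphic_comm_of_isTorsion`). Weaker than print (one base field, one tower), never
stronger. Consumer shape: `ℓ_𝔭(tors X(E/ℚ_∞)) = ℓ_{ι𝔭}(X₀(E/ℚ_∞))` at every height-one prime
(`Module.lengthAt_eq_of_isPseudoIsomorphism` + `Kato2004.fineSelmerDualData_lengthAt_inv_eq`) — the Wingberg/Matar step of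
the cokernel bound F-α♮ of the `SprungLowerDivisibilityAtThree` children.
-- TODO(general form): any number field `K`, any `ℤ_p`-extension in which every prime above `p` ramifies, hypotheses
-- (i) `E(K_∞)[p^∞]` finite and (ii) `H²(G_S(K_∞), E[p^∞]) = 0` as printed (needs `H²(G_S(K_∞), ·)` in the tree); `p = 2`.

## References
* A. Matar, *On the Λ-cotorsion subgroup of the Selmer group*, Asian J. Math. 24 (2020) 437–456, arXiv:1812.00207:
  Thm. 1.1 (p0003), Prop. 1.2 (ii) (p0004), Thm. 2.2 (p0005). [Matar2020]
* K. Wingberg, *Duality theorems for abelian varieties over ℤ_p-extensions*, Adv. Stud. Pure Math. 17 (1989) 471–492,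
  Cor. 2.5 (the flat-cohomological form). [Wingberg1989]
* R. Greenberg, *Iwasawa theory for p-adic representations*, Adv. Stud. Pure Math. 17 (1989), §0 pp. 101–102 (the module
  `S^ι`). [Greenberg1989]
* tree: `IwasawaSelmer` (`WeierstrassCurve.SelmerDualData`), `KatoFineSelmerDual` (`WeierstrassCurve.FineSelmerDualData`),
  `IwasawaAlgebra` (`Module.ArePseudoIsomorphic`), `Kato2004/IwasawaInvolutionTwistProofs` (the `ι`-twist dictionary).
-/

noncomputable section

open scoped Classical

open Literature.NumberTheory.EllipticCurves

namespace Literature.NumberTheory.EllipticCurves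

/-- **Matar 2020, Thm. 1.1 (with Thm. 2.2 and Prop. 1.2 (ii)) for `E/ℚ` along the cyclotomic `ℤ_p`-extension, `p` odd of
good supersingular reduction: the `Λ`-torsion submodule of `X(E/ℚ_∞) = Sel_{p^∞}(E/ℚ_∞)^∨` is pseudo-isomorphic to the
`ι`-twist of `X₀(E/ℚ_∞) = R_{p^∞}(E/ℚ_∞)^∨`** ("there exists a pseudo-isomorphism `Ṫ_Λ(Sel_{p^∞}(E/K_∞)^*) ∼
R_{p^∞}(E/K_∞)^*`", `Ȧ` = "`A` with the inverse `Λ`-action"), provided the fine dual is `Λ`-torsion (= hypothesis (ii)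
`H²(G_S(K_∞), E[p^∞]) = 0` by Thm. 2.2 for odd `p`; hypothesis (i) `E(K_∞)[p^∞]` finite holds for the cyclotomic tower
by Prop. 1.2 (ii)). On the tree's pinned duals: `S : W.SelmerDualData κ γ` and the fine datum `Y'` keyed by `γ'` with
`γ·γ' = 1` (the `ι`-twist of a key-`γ` fine datum — same-convention reading of `Ṫ_Λ(X) ∼ X₀`, i.e. `T_Λ(X) ∼ X₀^ι`;
module docstring KEYING). Named fact; nothing asserted; weaker than print (`K = ℚ`, cyclotomic tower), never stronger.
[cite: Matar2020, Thm. 1.1 (p. 438), Thm. 2.2, Prop. 1.2 (ii)] [cite: Wingberg1989, Cor. 2.5]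
[cite: Greenberg1989, §0 pp. 101–102] -/
def matar2020_thm11_selmerDualTorsion_pseudoIso_fineSelmerDual : Prop :=
  ∀ (W : WeierstrassCurve ℚ) [W.IsElliptic] [W.IsGloballyMinimal] (p : ℕ) [Fact p.Prime]
    (κ : ZpExtension ℚ p) (γ γ' : Field.absoluteGaloisGroup ℚ),
    p ≠ 2 → W.HasGoodReductionAtPrime p → (p : ℤ) ∣ W.frobeniusTrace p →
    κ.IsCyclotomic → κ.IsTopGenerator γ → γ * γ' = 1 →
    ∀ (S : W.SelmerDualData κ γ) (Y' : W.FineSelmerDualData κ γ'),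
      Module.IsTorsion (IwasawaAlgebra p) Y'.X →
      Module.ArePseudoIsomorphic (IwasawaAlgebra p)
        (Submodule.torsion (IwasawaAlgebra p) S.X) Y'.X

end Literature.NumberTheory.EllipticCurves

end
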